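import Summits.CriticalPhenomena.PercolationContinuityZ3.Theorems.PercNearOneGluingNoHeavyQuantDepthOneSubUnitRow
import HarnessLib

/-!
# QUANT lane R8, GRADED-CLOSURE programme: G₀ for EVERY PARTNER OF MEAN AT MOST TWO — part 1, the pointwise certificate

builds on p205010 (kernel theorem, internal audit signed; external expert review pending)

Support file (`--supports stmt-CriticalPhenomena-4575`), QUANT lane seat prim-quant-arm-1 (gen 44, architect seat, own initiative on the unowned node
'G₀ for a general partner'), rung R8 of `run/shared/lean/prim/quant/LADDER.md`; memo `run/shared/lean/prim/quant/prim-quant-arm-1-g44/G0-SUBUNIT-G44.md`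
§5.  Part 1 of 2 (this file: `subtwo_pointwise`, all the combinatorics; part 2 `…QuantDepthOneSubTwoRow`: the row theorem).  Theorems only,
standard axioms, no sorries; imports the companion `…QuantDepthOneSubUnitRow` (✓ p383717, partners of mean `≤ 1`) for `tlcCoeff_of_not_mid`.

STATEMENT (`subtwoConv_twoLayerRow_of_tlc`).  Floor `0 < y < 1` (ANY floor), `u = y/(1−y)`; `μ₁ ≥ 0` on `{0..M₁}` with the depth-1 family
`LawDec.TLC y T₁ M₁ μ₁`; `μ₂ ≥ 0` on `{0..M₂}` of which ONLY the row `u·μ₂ 0 ≤ Σ_{g₂ ≤ b ≤ M₂} μ₂ b` is used (`g₂ ∈ {1,2}`, `T₂ ≤ g₂`; with `g₂ = ⌈T₂⌉`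
its two-layer row `d = 0`); `0 < T₂ ≤ 2` (the partner's mean in the application: its only low atom is `0` — gated relays at any gate, gated pairs / blobs
`{0,m}` with `gm ≤ 2`, any law of mean `≤ 2`); `2d < T₁`; `j₀ < T₁+T₂−d ≤ j₀+1`, `j₀ < M₁`; and the TOP hole heavy: `T₁ − d < j₀ → usage y T₁ j₀ d j₀ ≥ 1`
(automatic when `T₁ − 2d ≥ 2`, `subtwo_hole_heavy_of_two_le_depth`; the other possible hole `j₀ − 1` is then heavy by `usage_anti_mid`).
CONCLUSION: the two-layer row `d` of `lconv M₁ M₂ μ₁ μ₂` at target `T₁ + T₂`.  No mass / mean / top-affordability hypothesis on either factor.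
CERTIFICATE (`subtwo_pointwise`): holes = atoms `h` with `T₁−d < h ≤ j₀` (`⊆ {j₀−1, j₀}`), `κ_h = 1/usage(d,h)`, `κ₀ ≤ κ₁ ≤ 1`; column `0`: `TLC(j₀,d)`;
columns `1 ≤ b < g₂`: `TLC(j₀−b, d−b)`; columns `g₂ ≤ b ≤ d`: `(1−κ₁)TLC(j₀−b,d−b) + κ₁TLC(j₀,d−b)` (room `κ₁` on `[j₀−b+1, j₀] ∋` both holes since
`j₀ ≤ ⌊T₁−d⌋ + g₂`); hole atoms carry the partner row `× κ_h`.  Every cell an identity or a sign.  `T₂ ≤ 1` (`g₂ = 1`) is the companion file's theorem.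
EVIDENCE: extracted from exact full-grid tensor LPs (engine `quant/prim-quant-arm-1-g44/code/`), verified exactly on 141 536 cells (`y ∈ [1/10,3/4]`, `M₁ ≤ 30`,
`M₂ ≤ 11`, all `T₂ ≤ 2`, every admissible `d`): 0 failures whenever the top hole is heavy; every failure of the formula has `κ₁ > 1`.  HONEST STATUS: support
lemma for the OPEN node G₀ (`LawDec.TLCGateConvTLB`); partners of mean `> 2` and the shallow top band (`κ₁ > 1`) remain; RATE class log\* / honest sentence of
`run/shared/lean/prim/quant/README.md` unchanged.
[this work]; relay case / depth-1 rows: prim-quant-census-2 g63/g64; tensor principle: prim-quant-arm-2 g38; `usage_anti_mid`: this lane.  Nothing here is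
cited as a published result.  The gluing rows served [cite: KozmaNitzan2024, Conjecture 3 (p. 15)]; product measure [cite: Grimmett1999, §1.3 p. 10].
-/

noncomputable section

namespace Summit.CriticalPhenomena.PercolationContinuityZ3.Theorems

namespace Quant

open Finset

namespace LawDec

/-! ### Partners of mean at most two: the certificate with two holes and a delayed mixing column -/

/-- **the pointwise certificate inequality for a partner of mean `≤ 2`.**  Data: `0 < y < 1`; `0 < T₂ ≤ g₂ ≤ 2`
(`g₂ ∈ {1,2}`, in the application `⌈T₂⌉` = the first column where the partner row `u·[b=0] − [g₂ ≤ b]` is negative); `2d < T₁`; `j₀ < T₁+T₂−d ≤ j₀+1`; hole weights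
`κ₁ = [T₁−d < j₀]/usage(d, j₀)`, `κ₀ = [T₁−d+1 < j₀]/usage(d, j₀−1)` with `0 ≤ κ₀ ≤ κ₁ ≤ 1`.  For every cell `(a,b)`:
`u[a+b ≤ d] − [T−d ≤ a+b] ≤ [b=0]·C_{j₀,d}(a) + [1 ≤ b < g₂, b ≤ d]·C_{j₀−b,d−b}(a) + [g₂ ≤ b ≤ d]·((1−κ₁)C_{j₀−b,d−b}(a) + κ₁C_{j₀,d−b}(a))`
`+ ([a=j₀]κ₁ + [a+1=j₀]κ₀)·(u[b=0] − [g₂ ≤ b])`. [this work] -/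
theorem subtwo_pointwise (y T₁ T₂ κ₁ κ₀ : ℝ) (d j₀ g₂ a b : ℕ) (hy0 : 0 < y) (hy1 : y < 1) (hT20 : 0 < T₂)
    (hg2b : T₂ ≤ (g₂ : ℝ)) (hg22 : g₂ ≤ 2)
    (hlow : 2 * (d : ℝ) < T₁) (hj0 : (j₀ : ℝ) < T₁ + T₂ - d) (hj0' : T₁ + T₂ - d ≤ (j₀ : ℝ) + 1)
    (hκ00 : 0 ≤ κ₀) (hκ01 : κ₀ ≤ κ₁) (hκ11 : κ₁ ≤ 1)
    (hκ1h : T₁ - d < (j₀ : ℝ) → κ₁ = 1 / usage y T₁ j₀ d j₀)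
    (hκ0h : T₁ - d + 1 < (j₀ : ℝ) → κ₀ = 1 / usage y T₁ j₀ d (j₀ - 1))
    (hκ0n : ¬ (T₁ - d + 1 < (j₀ : ℝ)) → κ₀ = 0) :
    y / (1 - y) * (if a + b ≤ d then (1 : ℝ) else 0) - (if T₁ + T₂ - d ≤ ((a + b : ℕ) : ℝ) then (1 : ℝ) else 0)
      ≤ (if b = 0 then (y / (1 - y) * (if a ≤ d then (1 : ℝ) else 0) - (if j₀ + 1 ≤ a then (1 : ℝ) else 0) - y / (1 - y) * (if a ≤ j₀ ∧ T₁ < ((d : ℕ) : ℝ) + a then 1 / usage y T₁ j₀ d a else 0)) else 0)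
        + (if 1 ≤ b ∧ b < g₂ ∧ b ≤ d then (y / (1 - y) * (if a ≤ (d - b) then (1 : ℝ) else 0) - (if (j₀ - b) + 1 ≤ a then (1 : ℝ) else 0) - y / (1 - y) * (if a ≤ (j₀ - b) ∧ T₁ < ((d - b : ℕ) : ℝ) + a then 1 / usage y T₁ (j₀ - b) (d - b) a else 0)) else 0)
        + (if g₂ ≤ b ∧ b ≤ d then (1 - κ₁) * (y / (1 - y) * (if a ≤ (d - b) then (1 : ℝ) else 0) - (if (j₀ - b) + 1 ≤ a then (1 : ℝ) else 0) - y / (1 - y) * (if a ≤ (j₀ - b) ∧ T₁ < ((d - b : ℕ) : ℝ) + a then 1 / usage y T₁ (j₀ - b) (d - b) a else 0)) + κ₁ * (y / (1 - y) * (if a ≤ (d - b) then (1 : ℝ) else 0) - (if j₀ + 1 ≤ a then (1 : ℝ) else 0) - y / (1 - y) * (if a ≤ j₀ ∧ T₁ < ((d - b : ℕ) : ℝ) + a then 1 / usage y T₁ j₀ (d - b) a else 0)) else 0)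
        + ((if a = j₀ then κ₁ else 0) + (if a + 1 = j₀ then κ₀ else 0)) * (y / (1 - y) * (if b = 0 then (1 : ℝ) else 0) - (if g₂ ≤ b then (1 : ℝ) else 0)) := by
  have h1y : 0 < 1 - y := by linarith
  have hu0 : 0 < y / (1 - y) := div_pos hy0 h1y
  have hκ10 : 0 ≤ κ₁ := le_trans hκ00 hκ01
  have hg21 : 1 ≤ g₂ := by
    have : (0 : ℝ) < g₂ := by linarith
    have : 0 < g₂ := by exact_mod_cast this
    omega
  have hdj : d ≤ j₀ := by
    have : (d : ℝ) < j₀ + 1 := by linarith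
    have : d < j₀ + 1 := by exact_mod_cast this
    omega
  have hgiant : ∀ n : ℕ, (T₁ + T₂ - d ≤ (n : ℝ)) ↔ j₀ + 1 ≤ n := by
    intro n; constructor
    · intro h
      have : (j₀ : ℝ) < n := by linarith
      exact Nat.succ_le_of_lt (by exact_mod_cast this)
    · exact fun h => le_trans hj0' (by exact_mod_cast h)
  have hG : (if T₁ + T₂ - d ≤ ((a + b : ℕ) : ℝ) then (1 : ℝ) else 0) = (if j₀ + 1 ≤ a + b then (1 : ℝ) else 0) := by
    by_cases h : j₀ + 1 ≤ a + b
    · rw [if_pos ((hgiant _).2 h), if_pos h]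
    · rw [if_neg (fun h' => h ((hgiant _).1 h')), if_neg h]
  rw [hG]
  have hg2r : (g₂ : ℝ) ≤ 2 := by exact_mod_cast hg22
  have hTd : (j₀ : ℝ) - 2 < T₁ - d := by linarith
  -- a second hole forces T₂ > 1, hence g₂ = 2
  have hg2_of_hole0 : T₁ - d + 1 < (j₀ : ℝ) → 2 ≤ g₂ := by
    intro h
    have : (1 : ℝ) < g₂ := by linarith
    have : 1 < g₂ := by exact_mod_cast this
    omega
  rcases Nat.eq_zero_or_pos b with hb0 | hbpos
  · ----------------------------------------------------------------- column b = 0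
    subst hb0
    have e0 : ∀ (x z : ℝ), (if (0 : ℕ) = 0 then x else z) = x := fun x z => if_pos rfl
    have e1 : ∀ (x z : ℝ), (if 1 ≤ (0 : ℕ) ∧ (0 : ℕ) < g₂ ∧ (0 : ℕ) ≤ d then x else z) = z := fun x z => if_neg (by omega)
    have e2 : ∀ (x z : ℝ), (if g₂ ≤ (0 : ℕ) ∧ (0 : ℕ) ≤ d then x else z) = z := fun x z => if_neg (by omega)
    have e3 : ∀ (x z : ℝ), (if g₂ ≤ (0 : ℕ) then x else z) = z := fun x z => if_neg (by omega)
    rw [Nat.add_zero, e0, e1, e2, e0, e3, add_zero, add_zero, mul_one, sub_zero]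
    by_cases hmid : a ≤ j₀ ∧ T₁ < (d : ℝ) + a
    · -- a is one of the two possible holes j₀, j₀ - 1
      have ha2 : j₀ ≤ a + 1 := by
        have : (j₀ : ℝ) < a + 2 := by linarith [hmid.2]
        have : j₀ < a + 2 := by exact_mod_cast this
        omega
      rw [if_pos hmid]
      rcases Nat.eq_or_lt_of_le hmid.1 with haj | haj
      · -- a = j₀
        have hhole : T₁ - d < (j₀ : ℝ) := by have := hmid.2; rw [haj] at this; linarith
        rw [if_pos haj, if_neg (by omega : ¬ (a + 1 = j₀)), hκ1h hhole, haj, add_zero]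
        apply le_of_eq; ring
      · -- a + 1 = j₀
        have haj' : a + 1 = j₀ := by omega
        have hcast : ((j₀ - 1 : ℕ) : ℝ) = (j₀ : ℝ) - 1 := by rw [Nat.cast_sub (by omega)]; push_cast; ring
        have har : (a : ℝ) = j₀ - 1 := by
          have : ((a + 1 : ℕ) : ℝ) = j₀ := by rw [haj']
          push_cast at this; linarith
        have hhole : T₁ - d + 1 < (j₀ : ℝ) := by have := hmid.2; rw [har] at this; linarith
        have hk := hκ0h hhole
        have hja : j₀ - 1 = a := by omega
        rw [hja] at hk
        rw [if_neg (by omega : ¬ (a = j₀)), if_pos haj', hk, zero_add]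
        apply le_of_eq; ring
    · rw [tlcCoeff_of_not_mid y T₁ j₀ d a hmid]
      have hlast : 0 ≤ ((if a = j₀ then κ₁ else 0) + (if a + 1 = j₀ then κ₀ else 0)) * (y / (1 - y)) := by
        refine mul_nonneg ?_ hu0.le
        refine add_nonneg ?_ ?_ <;> split_ifs
        exacts [hκ10, le_rfl, hκ00, le_rfl]
      linarith
  · have hb1 : 1 ≤ b := hbpos
    have hS : (y / (1 - y) * (if b = 0 then (1 : ℝ) else 0) - (if g₂ ≤ b then (1 : ℝ) else 0)) = -(if g₂ ≤ b then (1 : ℝ) else 0) := by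
      rw [if_neg (show b ≠ 0 by omega)]; ring
    rw [hS, if_neg (show b ≠ 0 by omega), zero_add]
    by_cases hbd : b ≤ d
    · have hcast : ((d - b : ℕ) : ℝ) = (d : ℝ) - b := by rw [Nat.cast_sub hbd]
      have hb1r : (1 : ℝ) ≤ b := by exact_mod_cast hb1
      have e1 : (if a + b ≤ d then (1 : ℝ) else 0) = (if a ≤ d - b then (1 : ℝ) else 0) := by
        by_cases h : a + b ≤ d
        · rw [if_pos h, if_pos (by omega)]
        · rw [if_neg h, if_neg (by omega)]
      have e2 : (if j₀ + 1 ≤ a + b then (1 : ℝ) else 0) = (if j₀ - b + 1 ≤ a then (1 : ℝ) else 0) := by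
        by_cases h : j₀ + 1 ≤ a + b
        · rw [if_pos h, if_pos (by omega)]
        · rw [if_neg h, if_neg (by omega)]
      rw [e1, e2]
      have hnm1 : ¬ (a ≤ j₀ - b ∧ T₁ < ((d - b : ℕ) : ℝ) + a) := by
        rintro ⟨h1, h2⟩
        rw [hcast] at h2
        have : (j₀ : ℝ) < a + 1 := by linarith
        have : j₀ < a + 1 := by exact_mod_cast this
        omega
      rw [tlcCoeff_of_not_mid y T₁ (j₀ - b) (d - b) a hnm1]
      have hI0 : 0 ≤ (if j₀ - b + 1 ≤ a then (1 : ℝ) else 0) := by split_ifs <;> norm_num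
      have hI1 : (if j₀ - b + 1 ≤ a then (1 : ℝ) else 0) ≤ 1 := by split_ifs <;> norm_num
      by_cases hbg : b < g₂
      · --------------------------------------------------------------- columns 1 ≤ b < g₂ (unmixed)
        rw [if_pos (show 1 ≤ b ∧ b < g₂ ∧ b ≤ d from ⟨hb1, hbg, hbd⟩), if_neg (show ¬ (g₂ ≤ b ∧ b ≤ d) by omega),
          if_neg (show ¬ (g₂ ≤ b) by omega), add_zero, neg_zero, mul_zero, add_zero]
      · --------------------------------------------------------------- columns g₂ ≤ b ≤ d (mixed)
        have hgb : g₂ ≤ b := by omega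
        rw [if_neg (show ¬ (1 ≤ b ∧ b < g₂ ∧ b ≤ d) by omega), zero_add, if_pos (show g₂ ≤ b ∧ b ≤ d from ⟨hgb, hbd⟩),
          if_pos hgb]
        have hgbr : (g₂ : ℝ) ≤ b := by exact_mod_cast hgb
        have hnm2 : ¬ (a ≤ j₀ ∧ T₁ < ((d - b : ℕ) : ℝ) + a) := by
          rintro ⟨h1, h2⟩
          rw [hcast] at h2
          have : (j₀ : ℝ) < a := by linarith
          have : j₀ < a := by exact_mod_cast this
          omega
        rw [tlcCoeff_of_not_mid y T₁ j₀ (d - b) a hnm2]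
        -- indicator inequality: κ₁([a ≥ j₀+1] + [a = j₀]) + κ₀[a+1 = j₀] ≤ κ₁[a ≥ j₀-b+1]
        have hGG : κ₁ * ((if j₀ + 1 ≤ a then (1 : ℝ) else 0) + (if a = j₀ then (1 : ℝ) else 0))
            + κ₀ * (if a + 1 = j₀ then (1 : ℝ) else 0) ≤ κ₁ * (if j₀ - b + 1 ≤ a then (1 : ℝ) else 0) := by
          by_cases h0 : T₁ - d + 1 < (j₀ : ℝ)
          · have hb2 : 2 ≤ b := le_trans (hg2_of_hole0 h0) hgb
            have : (if j₀ + 1 ≤ a then (1 : ℝ) else 0) + (if a = j₀ then (1 : ℝ) else 0) + (if a + 1 = j₀ then (1 : ℝ) else 0)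
                ≤ (if j₀ - b + 1 ≤ a then (1 : ℝ) else 0) := by
              by_cases h1 : j₀ + 1 ≤ a
              · rw [if_pos h1, if_neg (by omega), if_neg (by omega), if_pos (by omega)]; norm_num
              · rw [if_neg h1]
                by_cases h2 : a = j₀
                · rw [if_pos h2, if_neg (by omega), if_pos (by omega)]; norm_num
                · rw [if_neg h2]
                  by_cases h3 : a + 1 = j₀
                  · rw [if_pos h3, if_pos (by omega)]; norm_num
                  · rw [if_neg h3]; norm_num; split_ifs <;> norm_num
            have hI3 : 0 ≤ (if a + 1 = j₀ then (1 : ℝ) else 0) := by split_ifs <;> norm_num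
            nlinarith [this, hI3, hκ01, hκ00, hκ10]
          · rw [hκ0n h0, zero_mul, add_zero]
            have : (if j₀ + 1 ≤ a then (1 : ℝ) else 0) + (if a = j₀ then (1 : ℝ) else 0)
                ≤ (if j₀ - b + 1 ≤ a then (1 : ℝ) else 0) := by
              by_cases h1 : j₀ + 1 ≤ a
              · rw [if_pos h1, if_neg (by omega), if_pos (by omega)]; norm_num
              · rw [if_neg h1]
                by_cases h2 : a = j₀
                · rw [if_pos h2, if_pos (by omega)]; norm_num
                · rw [if_neg h2]; norm_num; split_ifs <;> norm_num
            exact mul_le_mul_of_nonneg_left this hκ10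
        have hK1 : (if a = j₀ then κ₁ else 0) = κ₁ * (if a = j₀ then (1 : ℝ) else 0) := by split_ifs <;> ring
        have hK0 : (if a + 1 = j₀ then κ₀ else 0) = κ₀ * (if a + 1 = j₀ then (1 : ℝ) else 0) := by split_ifs <;> ring
        rw [hK1, hK0]
        nlinarith [hGG, hI0, hI1, hκ10, hκ11, hκ00]
    · ----------------------------------------------------------------- columns b > d
      rw [if_neg (show ¬ (1 ≤ b ∧ b < g₂ ∧ b ≤ d) by omega), if_neg (show ¬ (g₂ ≤ b ∧ b ≤ d) by omega), add_zero, zero_add,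
        if_neg (show ¬ (a + b ≤ d) by omega), mul_zero, zero_sub]
      by_cases hgb : g₂ ≤ b
      · rw [if_pos hgb]
        by_cases haj : a = j₀
        · rw [if_pos haj, if_neg (by omega : ¬ (a + 1 = j₀)), if_pos (show j₀ + 1 ≤ a + b by omega)]; linarith
        · rw [if_neg haj]
          by_cases haj' : a + 1 = j₀
          · rw [if_pos haj']
            by_cases h0 : T₁ - d + 1 < (j₀ : ℝ)
            · have hb2 : 2 ≤ b := le_trans (hg2_of_hole0 h0) hgb
              rw [if_pos (show j₀ + 1 ≤ a + b by omega)]; linarith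
            · rw [hκ0n h0]; split_ifs <;> linarith
          · rw [if_neg haj']; split_ifs <;> linarith
      · rw [if_neg hgb]; split_ifs <;> linarith


end LawDec

end Quant

end Summit.CriticalPhenomena.PercolationContinuityZ3.Theorems
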